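import Summits.AtomisticToContinuum.Crystallization.Theorems.ChartedZeroExcessLayeredLatticeLiouvilleZY
import Summits.AtomisticToContinuum.Crystallization.Theorems.ChartedZeroExcessLayeredLatticeLiouvilleZJ

/-!
(SPLIT FOR THE 400-LINE CAP by the landing lane, hand-2 g39: this file = part A; part B = `…ChartedZeroExcessLayeredLatticeLiouvilleZZR` imports it; same namespace, all FQNs unchanged.)
# Charted zero-excess layered lattices — Part ZZR: LEMMA Θ (B′.4), the index side

Route `ChartedPlanarOrder`, station L2′, booked junction (g79/g81)
`(GL) ⟸ X_Θ ∧ (C)` (Part ZZP, `exists_isBondLabel_of_slabIso`).  This part manufactures the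
global index map `Θ` of `X_Θ` from NORMALISED LINK MAPS on a Barlow-connected window.

## Input (the normalised output of Parts ZZ / ZZA / ZZB)

A window `W ⊆ ℤ × ℤ × ℤ` of the source Barlow graph (letters `τ`), an index map `g` into the
target Barlow graph (letters `τ'`) and, at every `x ∈ W`,
* `IsLinkMap τ τ' g x` (Part ZV: `g` maps the closed link of `x` isomorphically into the link of `g x`),
* `CapType τ g x` (the six in-layer neighbours stay in the layer of `g x`),
* `UpSign τ g x 1` (upper caps go up, lower caps go down),
* `(g x).1 = x.1` (sheets are already aligned — Part ZZB `exists_relabel_fst`),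
and `W` is connected through source bonds (`Relation.ReflTransGen` of `BarlowAdj τ` inside `W`).

## Output

`exists_slabIso_of_window`: ONE pair `(j, ε)` (point group element `loRot j ε`, Part ZD) and ONE
family of sheet translations `t : ℤ → ℤ × ℤ` obeying the TRANSLATION LAW
`t (k + 1) = t k + capShift j ε (τ k)` for all `k`, such that the explicit SLAB MAP
`slabMap j ε t z = (z.1, t z.1 + loRot j ε z.2)` agrees with `g` on `W` and on every neighbour of
a site of `W`, together with the LETTER LAW `τ' k = capType j ε (τ k)` on the sheets `k = x.1`,
`x.1 - 1` (`x ∈ W`).  `exists_slabIso` repackages this in the shape consumed by Parts ZZP / ZZQ: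
`Θ` injective and surjective, sheet-preserving, `Θ = g` near `W`, and
`BarlowAdj τ x z ↔ BarlowAdj τ' (Θ x) (Θ z)` whenever the sheet of `x` meets `W`.

## Proof

* GERM (`linkMap_germ`): at one site the hexagon of in-layer neighbours is rigid
  (`hexagon_rigidity_at`, Part ZD), so `g` is affine `p ↦ a + loRot j ε p` on `{x} ∪ hexagon`;
  each upper cap site has its three lower neighbours inside `{x} ∪ hexagon`, so `cap_forcing`
  (Part ZE) forces the upper letter and the upper translation `a + capShift j ε (τ x.1)`;
  symmetrically `cap_forcing_down` (proved here) forces the lower letter and translation.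
* POTENTIAL (`exists_potential`): the translation law is integrated once and for all from the
  germ at the base point.
* PROPAGATION: along a bond `b — c` of `W` the two germs are compared on a unit triangle of the
  sheet of `c` lying in both closed links (`exists_pin_triangle`); `affine_pinning` (Part ZD)
  identifies translation, `j` and `ε`; induction on the path.

No metric enters; no new letters, tables or instances.  Decide hygiene: three finite facts about
`triVert`, one lemma each, plain `decide`.
-/

namespace Summit.AtomisticToContinuum.Crystallization.Theorems.ChartedZeroExcessLayeredLatticeLiouville

/-! ### ZZR-1  Slab maps -/

/-- the SLAB MAP with point-group part `loRot j ε` and sheet translations `t`: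
`(k, p) ↦ (k, t k + loRot j ε p)`. -/
def slabMap (j : Fin 6) (ε : Bool) (t : ℤ → ℤ × ℤ) (z : ℤ × ℤ × ℤ) : ℤ × ℤ × ℤ :=
  (z.1, t z.1 + loRot j ε z.2)

/-- `slabMap` preserves the first (layer) coordinate (lane docstring, hand-2 g39). -/
theorem slabMap_fst (j : Fin 6) (ε : Bool) (t : ℤ → ℤ × ℤ) (z : ℤ × ℤ × ℤ) :
    (slabMap j ε t z).1 = z.1 := rfl

/-- `slabMap j ε t` is injective (lane docstring, hand-2 g39). -/
theorem slabMap_injective (j : Fin 6) (ε : Bool) (t : ℤ → ℤ × ℤ) :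
    Function.Injective (slabMap j ε t) := by
  rintro ⟨k, p⟩ ⟨k', p'⟩ h
  simp only [slabMap, Prod.mk.injEq] at h
  obtain ⟨rfl, h2⟩ := h
  simp only [Prod.mk.injEq, true_and]
  exact loRot_injective j ε (add_left_cancel h2)

/-- the point-group maps are onto `ℤ × ℤ`. -/
theorem loRot_surjective (j : Fin 6) (ε : Bool) : Function.Surjective (loRot j ε) := by
  intro q
  obtain ⟨a, b, hq⟩ := loDir_basis 0 q
  obtain ⟨k₀, hk₀⟩ := exists_loRot_loDir_eq j ε 0
  obtain ⟨k₁, hk₁⟩ := exists_loRot_loDir_eq j ε (0 + 1)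
  refine ⟨a • loDir k₀ + b • loDir k₁, ?_⟩
  rw [loRot_add, loRot_zsmul, loRot_zsmul, hk₀, hk₁, hq]
  ext <;> simp

/-- `slabMap j ε t` is surjective (lane docstring, hand-2 g39). -/
theorem slabMap_surjective (j : Fin 6) (ε : Bool) (t : ℤ → ℤ × ℤ) :
    Function.Surjective (slabMap j ε t) := by
  rintro ⟨k, q⟩
  obtain ⟨p, hp⟩ := loRot_surjective j ε (q - t k)
  exact ⟨(k, p), by simp [slabMap, hp]⟩

/-- SHEET POTENTIAL: any increment function integrates to a family of translations with a
prescribed value on one sheet. -/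
theorem exists_potential (d : ℤ → ℤ × ℤ) (k₀ : ℤ) (a : ℤ × ℤ) :
    ∃ t : ℤ → ℤ × ℤ, t k₀ = a ∧ ∀ k, t (k + 1) = t k + d k := by
  refine ⟨fun k => a + (∑ i ∈ Finset.range (k - k₀).toNat, d (k₀ + i)) -
    ∑ i ∈ Finset.range (k₀ - k).toNat, d (k + i), by simp, fun k => ?_⟩
  simp only
  rcases le_or_gt k₀ k with h | h
  · have e1 : (k + 1 - k₀).toNat = (k - k₀).toNat + 1 := by omega
    have e2 : (k₀ - (k + 1)).toNat = 0 := by omega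
    have e3 : (k₀ - k).toNat = 0 := by omega
    have e4 : k₀ + ((k - k₀).toNat : ℤ) = k := by omega
    rw [e1, e2, e3, Finset.sum_range_succ, e4]
    simp only [Finset.sum_range_zero, sub_zero]
    abel
  · have e1 : (k + 1 - k₀).toNat = 0 := by omega
    have e2 : (k - k₀).toNat = 0 := by omega
    have e3 : (k₀ - k).toNat = (k₀ - (k + 1)).toNat + 1 := by omega
    rw [e1, e2, e3, Finset.sum_range_succ']
    simp only [Finset.sum_range_zero, add_zero, Nat.cast_zero, Nat.cast_succ]
    have e4 : ∀ i : ℕ, k + ((i : ℤ) + 1) = k + 1 + i := fun i => by ring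
    simp only [e4]
    abel

/-! ### ZZR-2  Adjacency under slab maps -/

/-- cross adjacency is INVARIANT (both directions) under the cap-matched affine lift
(`crossAdj_lift`, Part ZE, is the forward direction). -/
theorem crossAdj_affine_iff (a p q : ℤ × ℤ) (j : Fin 6) (ε τ : Bool) :
    CrossAdj (capType j ε τ) (a + loRot j ε p) ((a + capShift j ε τ) + loRot j ε q) ↔ CrossAdj τ p q := by
  refine ⟨fun ⟨i', hi'⟩ => ?_, crossAdj_lift a p q j ε τ⟩
  obtain ⟨i, hi⟩ := loRot_triVert' j ε τ i'
  refine ⟨i, loRot_injective j ε ?_⟩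
  rw [loRot_add, hi]
  linear_combination hi'

/-- ★ a slab map whose translations obey the translation law and whose letters obey the letter
law on the sheets `x.1`, `x.1 - 1` preserves and reflects Barlow adjacency at `x`. -/
theorem barlowAdj_slabMap_iff {τ τ' : ℤ → Bool} {j : Fin 6} {ε : Bool} {t : ℤ → ℤ × ℤ}
    (ht : ∀ k, t (k + 1) = t k + capShift j ε (τ k)) {x : ℤ × ℤ × ℤ}
    (h₁ : τ' x.1 = capType j ε (τ x.1)) (h₂ : τ' (x.1 - 1) = capType j ε (τ (x.1 - 1)))
    (z : ℤ × ℤ × ℤ) :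
    BarlowAdj τ x z ↔ BarlowAdj τ' (slabMap j ε t x) (slabMap j ε t z) := by
  obtain ⟨k, p⟩ := x
  obtain ⟨k', q⟩ := z
  simp only at h₁ h₂
  simp only [BarlowAdj, slabMap]
  refine or_congr ?_ (or_congr ?_ ?_)
  · refine and_congr_right fun hk => ?_
    rw [hk, loAdj_affine_iff]
  · refine and_congr_right fun hk => ?_
    rw [hk, ht k, h₁, crossAdj_affine_iff]
  · refine and_congr_right fun hk => ?_
    have hk' : k' = k - 1 := by omega
    subst hk'
    have htk := ht (k - 1)
    rw [sub_add_cancel] at htk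
    rw [htk, h₂, crossAdj_affine_iff]

/-! ### ZZR-3  Finite facts about the cap triangles and the downward cap forcing -/

/-- two vertices of a cap triangle coincide or differ by an in-layer bond vector. [decide] -/
theorem triVert_sub_triVert_cases (β : Bool) (i l : Fin 3) :
    triVert β l - triVert β i = 0 ∨ ∃ m : Fin 6, triVert β l - triVert β i = loDir m := by
  revert β i l
  decide

/-- the reflected cap triangle `{0, -triVert β 1, -triVert β 2}` is a unit triangle `{0, loDir m, loDir (m+1)}`. [decide] -/
theorem neg_triVert_one_two (β : Bool) :
    ∃ m : Fin 6, -triVert β 1 = loDir m ∧ -triVert β 2 = loDir (m + 1) := by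
  revert β
  decide

/-- the cap triangle `{0, triVert β 1, triVert β 2}` is a unit triangle `{0, loDir m, loDir (m+1)}`. [decide] -/
theorem triVert_one_two (β : Bool) :
    ∃ m : Fin 6, triVert β 1 = loDir m ∧ triVert β 2 = loDir (m + 1) := by
  revert β
  decide

/-- DOWNWARD CAP FORCING (the mirror image of `cap_forcing`, Part ZE): if a point `y` of the sheet
BELOW is cross-adjacent (as the lower endpoint, lower letter `τ'`) to the affine images
`a + loRot j ε (r - triVert τ i)` of the three upper neighbours of a lower cap site `r`, then the
lower letter is `capType j ε τ` and `y = a - capShift j ε τ + loRot j ε r`. -/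
theorem cap_forcing_down (a r y : ℤ × ℤ) (j : Fin 6) (ε τ τ' : Bool)
    (h : ∀ i : Fin 3, CrossAdj τ' y (a + loRot j ε (r - triVert τ i))) :
    τ' = capType j ε τ ∧ y = a - capShift j ε τ + loRot j ε r := by
  have key : ∀ i₂ : Fin 3, ∃ i' : Fin 3,
      (y - a - loRot j ε r + capShift j ε τ) + triVert (capType j ε τ) i₂ = triVert τ' i' := by
    intro i₂
    obtain ⟨i, hi⟩ := loRot_triVert' j ε τ i₂
    obtain ⟨i', hi'⟩ := h i
    refine ⟨i', ?_⟩
    rw [loRot_sub, hi] at hi'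
    linear_combination hi'
  obtain ⟨hz, hτ⟩ := triVert_sub_triVert _ _ _ key
  exact ⟨hτ.symm, by linear_combination hz⟩

/-! ### ZZR-4  Link maps: adjacency bookkeeping -/

/-- A link map carries `τ`-bonds at `x` to `τ'`-bonds at `g x` (lane docstring, hand-2 g39). -/
theorem IsLinkMap.adj {τ τ' : ℤ → Bool} {g : ℤ × ℤ × ℤ → ℤ × ℤ × ℤ} {x : ℤ × ℤ × ℤ}
    (h : IsLinkMap τ τ' g x) {z : ℤ × ℤ × ℤ} (hz : BarlowAdj τ x z) : BarlowAdj τ' (g x) (g z) := by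
  obtain ⟨i, rfl⟩ := exists_linkPt_of_barlowAdj hz
  exact h.1 i

/-- A link map preserves and reflects adjacency between two neighbours of `x` (lane docstring, hand-2 g39). -/
theorem IsLinkMap.adj_iff {τ τ' : ℤ → Bool} {g : ℤ × ℤ × ℤ → ℤ × ℤ × ℤ} {x : ℤ × ℤ × ℤ}
    (h : IsLinkMap τ τ' g x) {z z' : ℤ × ℤ × ℤ} (hz : BarlowAdj τ x z) (hz' : BarlowAdj τ x z') :
    BarlowAdj τ z z' ↔ BarlowAdj τ' (g z) (g z') := by
  obtain ⟨i, rfl⟩ := exists_linkPt_of_barlowAdj hz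
  obtain ⟨i', rfl⟩ := exists_linkPt_of_barlowAdj hz'
  exact h.2.1 i i'

/-- A link map is injective on the neighbours of `x` (lane docstring, hand-2 g39). -/
theorem IsLinkMap.inj {τ τ' : ℤ → Bool} {g : ℤ × ℤ × ℤ → ℤ × ℤ × ℤ} {x : ℤ × ℤ × ℤ}
    (h : IsLinkMap τ τ' g x) {z z' : ℤ × ℤ × ℤ} (hz : BarlowAdj τ x z) (hz' : BarlowAdj τ x z')
    (he : g z = g z') : z = z' := by
  obtain ⟨i, rfl⟩ := exists_linkPt_of_barlowAdj hz
  obtain ⟨i', rfl⟩ := exists_linkPt_of_barlowAdj hz'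
  exact congrArg (linkPt τ x) (h.2.2 he)

/-- under `CapType`, an in-layer neighbour is mapped into the layer of `g x`. -/
theorem CapType.fst_same {τ τ' : ℤ → Bool} {g : ℤ × ℤ × ℤ → ℤ × ℤ × ℤ} {x : ℤ × ℤ × ℤ}
    (hcap : CapType τ g x) (hlm : IsLinkMap τ τ' g x) {z : ℤ × ℤ × ℤ} (hz : BarlowAdj τ x z)
    (he : z.1 = x.1) : (g z).1 = (g x).1 := by
  obtain ⟨i, rfl⟩ := exists_linkPt_of_barlowAdj hz
  rw [linkPt_fst] at he
  have h0 : (linkSite (τ (x.1 - 1)) (τ x.1) i).1 = 0 := by omega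
  exact hcap.inLayer hlm i ((linkSite_fst_eq_zero_iff _ _ i).1 h0)

/-- under `UpSign … 1`, an upper neighbour is mapped one sheet up. -/
theorem UpSign.fst_up {τ : ℤ → Bool} {g : ℤ × ℤ × ℤ → ℤ × ℤ × ℤ} {x : ℤ × ℤ × ℤ}
    (hup : UpSign τ g x 1) {z : ℤ × ℤ × ℤ} (hz : BarlowAdj τ x z) (he : z.1 = x.1 + 1) :
    (g z).1 = (g x).1 + 1 := by
  obtain ⟨i, rfl⟩ := exists_linkPt_of_barlowAdj hz
  rw [linkPt_fst] at he
  have h1 : (linkSite (τ (x.1 - 1)) (τ x.1) i).1 = 1 := by omega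
  obtain ⟨h6, h8⟩ := (linkSite_fst_eq_one_iff _ _ i).1 h1
  exact hup.1 i h6 h8

/-- under `UpSign … 1`, a lower neighbour is mapped one sheet down. -/
theorem UpSign.fst_down {τ : ℤ → Bool} {g : ℤ × ℤ × ℤ → ℤ × ℤ × ℤ} {x : ℤ × ℤ × ℤ}
    (hup : UpSign τ g x 1) {z : ℤ × ℤ × ℤ} (hz : BarlowAdj τ x z) (he : x.1 = z.1 + 1) :
    (g z).1 = (g x).1 - 1 := by
  obtain ⟨i, rfl⟩ := exists_linkPt_of_barlowAdj hz
  rw [linkPt_fst] at he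
  have h1 : (linkSite (τ (x.1 - 1)) (τ x.1) i).1 = -1 := by omega
  exact hup.2 i ((linkSite_fst_eq_neg_one_iff _ _ i).1 h1)

/-! ### ZZR-5  The germ of a normalised link map -/

/-- ★★ GERM LEMMA.  A normalised link map (`IsLinkMap`, `CapType`, `UpSign … 1`, sheet-aligned) is,
on the closed link of `x`, the restriction of an affine slab map: there are a translation `a` and a
point-group element `(j, ε)` with
* the LETTER LAW on the sheets `x.1` and `x.1 - 1`,
* `g x = (x.1, a + loRot j ε x.2)` and the same formula on the in-layer hexagon,
* the upper cap sites mapped by translation `a + capShift j ε (τ x.1)`,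
* the lower cap sites mapped by translation `a - capShift j ε (τ (x.1 - 1))`. -/
theorem linkMap_germ {τ τ' : ℤ → Bool} {g : ℤ × ℤ × ℤ → ℤ × ℤ × ℤ} {x : ℤ × ℤ × ℤ}
    (hlm : IsLinkMap τ τ' g x) (hcap : CapType τ g x) (hup : UpSign τ g x 1) (hfst : (g x).1 = x.1) :
    ∃ (a : ℤ × ℤ) (j : Fin 6) (ε : Bool),
      τ' x.1 = capType j ε (τ x.1) ∧ τ' (x.1 - 1) = capType j ε (τ (x.1 - 1)) ∧
      g x = (x.1, a + loRot j ε x.2) ∧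
      (∀ q, LoAdj x.2 q → g (x.1, q) = (x.1, a + loRot j ε q)) ∧
      (∀ q, CrossAdj (τ x.1) x.2 q →
        g (x.1 + 1, q) = (x.1 + 1, (a + capShift j ε (τ x.1)) + loRot j ε q)) ∧
      (∀ q, CrossAdj (τ (x.1 - 1)) q x.2 →
        g (x.1 - 1, q) = (x.1 - 1, (a - capShift j ε (τ (x.1 - 1))) + loRot j ε q)) := by
  obtain ⟨k, u⟩ := x
  simp only at hfst ⊢
  -- the hexagon
  have hadjH : ∀ m : Fin 6, BarlowAdj τ (k, u) (k, u + loDir m) := fun m => Or.inl ⟨rfl, m, rfl⟩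
  have hH1 : ∀ m : Fin 6, (g (k, u + loDir m)).1 = k := fun m =>
    (hcap.fst_same hlm (hadjH m) rfl).trans hfst
  set f : ℤ × ℤ → ℤ × ℤ := fun p => (g (k, p)).2 with hf
  have hgx : g (k, u) = (k, f u) := Prod.ext hfst rfl
  have hgm : ∀ m, g (k, u + loDir m) = (k, f (u + loDir m)) := fun m => Prod.ext (hH1 m) rfl
  obtain ⟨j, ε, hhex⟩ := hexagon_rigidity_at f u
    (fun m => loAdj_of_barlowAdj (hlm.adj (hadjH m)) ((hH1 m).trans hfst.symm))
    (fun m m' hmm => by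
      obtain ⟨n, hn⟩ := hmm
      have hb : BarlowAdj τ (k, u + loDir m) (k, u + loDir m') :=
        Or.inl ⟨rfl, n, by simp only; rw [hn, add_assoc]⟩
      exact loAdj_of_barlowAdj ((hlm.adj_iff (hadjH m) (hadjH m')).1 hb) ((hH1 m').trans (hH1 m).symm))
    (fun m m' hmm => by
      have he : g (k, u + loDir m) = g (k, u + loDir m') := by rw [hgm, hgm, hmm]
      have h := hlm.inj (hadjH m) (hadjH m') he
      exact loDir_injective (add_left_cancel (Prod.mk.inj h).2))
  set a : ℤ × ℤ := f u - loRot j ε u with ha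
  have hfu : f u = a + loRot j ε u := by rw [ha]; abel
  have hPm : ∀ m, g (k, u + loDir m) = (k, a + loRot j ε (u + loDir m)) := fun m => by
    rw [hgm, hhex, hfu, loRot_add, add_assoc]
  -- the sites of `{u} ∪ hexagon`, addressed by their difference to `u`
  have hP : ∀ p, (p - u = 0 ∨ ∃ m, p - u = loDir m) →
      g (k, p) = (k, a + loRot j ε p) ∧ (((k, p) : ℤ × ℤ × ℤ) = (k, u) ∨ BarlowAdj τ (k, u) (k, p)) := by
    rintro p (h | ⟨m, hm⟩)
    · obtain rfl : p = u := sub_eq_zero.1 h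
      exact ⟨by rw [hgx, hfu], Or.inl rfl⟩
    · obtain rfl : p = u + loDir m := by rw [← hm]; abel
      exact ⟨hPm m, Or.inr (hadjH m)⟩
  -- adjacency of images, from a site of `{x} ∪ link` to a site of the link
  have hAdj : ∀ z z' : ℤ × ℤ × ℤ, (z = (k, u) ∨ BarlowAdj τ (k, u) z) → BarlowAdj τ (k, u) z' →
      BarlowAdj τ z z' → BarlowAdj τ' (g z) (g z') := by
    rintro z z' (rfl | hz) hz' hzz'
    · exact hlm.adj hz'
    · exact (hlm.adj_iff hz hz').1 hzz'
  -- upper caps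
  have hU : ∀ q, CrossAdj (τ k) u q →
      τ' k = capType j ε (τ k) ∧ g (k + 1, q) = (k + 1, (a + capShift j ε (τ k)) + loRot j ε q) := by
    rintro q ⟨i, hi⟩
    have hzq : BarlowAdj τ (k, u) (k + 1, q) := Or.inr (Or.inl ⟨rfl, i, hi⟩)
    have hq1 : (g (k + 1, q)).1 = k + 1 := by rw [hup.fst_up hzq rfl, hfst]
    have hforce := cap_forcing a q (g (k + 1, q)).2 j ε (τ k) (τ' k) (fun l => by
      have hdiff : (q + triVert (τ k) l) - u = 0 ∨ ∃ m, (q + triVert (τ k) l) - u = loDir m := by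
        rw [hi, show q + triVert (τ k) l - (q + triVert (τ k) i) = triVert (τ k) l - triVert (τ k) i by abel]
        exact triVert_sub_triVert_cases (τ k) i l
      obtain ⟨hgp, hp⟩ := hP _ hdiff
      have hb : BarlowAdj τ (k, q + triVert (τ k) l) (k + 1, q) := Or.inr (Or.inl ⟨rfl, l, rfl⟩)
      have hb' := hAdj _ _ hp hzq hb
      have hc := crossAdj_of_barlowAdj hb' (by rw [hq1, hgp])
      rw [hgp] at hc
      exact hc)
    exact ⟨hforce.1, Prod.ext hq1 hforce.2⟩
  -- lower caps
  have hD : ∀ q, CrossAdj (τ (k - 1)) q u →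
      τ' (k - 1) = capType j ε (τ (k - 1)) ∧
        g (k - 1, q) = (k - 1, (a - capShift j ε (τ (k - 1))) + loRot j ε q) := by
    rintro q ⟨i, hi⟩
    have hzq : BarlowAdj τ (k, u) (k - 1, q) := Or.inr (Or.inr ⟨by simp only; omega, i, hi⟩)
    have hq1 : (g (k - 1, q)).1 = k - 1 := by
      rw [hup.fst_down hzq (by simp only; omega), hfst]
    have hforce := cap_forcing_down a q (g (k - 1, q)).2 j ε (τ (k - 1)) (τ' (k - 1)) (fun l => by
      have hdiff : (q - triVert (τ (k - 1)) l) - u = 0 ∨ ∃ m, (q - triVert (τ (k - 1)) l) - u = loDir m := by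
        rw [hi, show u + triVert (τ (k - 1)) i - triVert (τ (k - 1)) l - u =
          triVert (τ (k - 1)) i - triVert (τ (k - 1)) l by abel]
        exact triVert_sub_triVert_cases (τ (k - 1)) l i
      obtain ⟨hgp, hp⟩ := hP _ hdiff
      have hb : BarlowAdj τ (k - 1, q) (k, q - triVert (τ (k - 1)) l) :=
        Or.inr (Or.inl ⟨by simp only; omega, l, by simp⟩)
      have hb' := barlowAdj_symm (hAdj _ _ hp hzq (barlowAdj_symm hb))
      have hc := crossAdj_of_barlowAdj hb' (by rw [hq1, hgp]; simp only; omega)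
      rw [hgp, hq1] at hc
      exact hc)
    exact ⟨hforce.1, Prod.ext hq1 hforce.2⟩
  refine ⟨a, j, ε, (hU u (crossAdj_self _ u)).1, (hD u (crossAdj_self _ u)).1, by rw [hgx, hfu],
    fun q hq => ?_, fun q hq => (hU q hq).2, fun q hq => (hD q hq).2⟩
  obtain ⟨m, rfl⟩ := hq
  exact hPm m

end Summit.AtomisticToContinuum.Crystallization.Theorems.ChartedZeroExcessLayeredLatticeLiouville
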